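import Summits.QuantumFields.BalabanUV.Beta.GAN24.FaceReadTransportStep
import Summits.QuantumFields.BalabanUV.Beta.GAN24.FaceReadTranspose
import Summits.QuantumFields.BalabanUV.Beta.GAN24.T2RecChargeStepMap
import Summits.QuantumFields.BalabanUV.Beta.GAN24.LinT2CoDressedStep

/-!
# `BalabanUV.Beta.GAN24.CombChargeTowerStepDeep` — binder row G-an2-4 ∕ (CONV-C), W-slot (α-0), ROW (C) AT LEVELS `≥ 1`: **THE PERIOD-INDEX-`m ≥ 1` ROWS OF THE
# OWNER's TWO-INDEX PAIR-FORM TOWER** (`PairFormPeriodTower.pairFormLS_tower₂`, RULING R-gan24p1-g40-1) **ARE ROAD-P2's E-FRAME STEP READ ON FACES — the member's period-`P`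
# bond-symmetrised four exit-face read is the forcing's plus `c·K_j⁴` times the member's period-`Lc·P` read ONE LEVEL DOWN, `c·K_j⁴ = 1` EXACTLY at the pins**:
#   `FFsym_P(T̃_{j+1}) = FFsym_P(b̃_j) + c·K_j⁴·FFsym_{Lc·P}(T̃_j)`,  `FFsym_M(Y)(μ,ν;α,β) := FF_M(Y)(μ,ν;α,β) + FF_M(Y)(ν,μ;α,β)`,  `c = cE₂·Lc^{2(d+1)}`, `K_j = s_f s_m (stepScale_j·Lc^{d+1})⁻¹`
# (road-P2 chair `b2b-balaban-gan24-p2`, gen 50; journal [GAN24P2-G50-INTENT3]; companion of `CombChargeTowerStepZero` (the `m = 0` row) and of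
# `FaceReadTransportStep.faceRead_lin4_coDress` (the transport at every period))

NOT IN PRINT; OUR BOOKKEEPING ([folklore] BY NAME: road-P2 g36 `T2RecChargeStep.succ_eq_lin4_dress_add` ∕ leaf-06 `LinT2CoDressedStep.lin4_comb_coDressKBmAt` (the E-frame split
`T̃_{j+1} = lin4 c G̃_j Lc T̃_j + b̃_j`), this gen's `FaceReadTransportStep.faceRead_lin4_coDress` (the transport row) and `FaceReadTransportCharges.nestedFace_add` (additivity of the face
read), the OWNER's `FaceReadTranspose.faceRead_transpose_of_cov` (the slot-transposed read is the bond-swapped read), `shape_member ∕ shape_source ∕ member_translate` (the member and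
the forcing are `LocStencil₂`, the member is jointly covariant); eight instances + `ring` for the `LS` rows; `field_simp` for the pin; 0 `def`, 0 cited fact, 0 `def … : Prop`, 0 sorry).
HONEST FRAMING (cell contract, verbatim): «discharging `BetaPertH` makes Bałaban's UV stability UNCONDITIONAL — a real constructive-QFT result; it is NOT the continuum limit and NOT
the Clay problem.»  HONEST DEPENDENCY (verbatim): «continuum YM on T⁴ ⇐ BetaPertH ∧ nine spine estimates (0/9 proved); BetaPertH ⇐ (D1) ∧ (D4) ∧ CAP+tail; G-an2-4 gates asym, D1
and NE2/3/4.»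

WHAT (generic `d`, cell `Lc ≥ 1`, in-block root `r ∈ box (d+1) Lc`, every level `j`, every coarse period `P ≥ 1`, ALL constants `cE cVH cΛ cE₂ cB Tc` symbolic; the border `vh₂S` a
generic jointly `Lc`-covariant `LocStencil₂` table with zero ff and mm blocks — `T2RecChargeStep.zmode_succ_eq`'s letters VERBATIM; `FF_M(Y)(μ,ν;α,β) := Σ_{b∈box M} Σ'_{u′} Σ'_x Σ'_z
[b_μ, u′_ν, x_α, z_β ≡ −1 (M)]·Y μ b ν u′ x z (inl α)(inl β)`, ONE conjunctive mask, cell `box M` — `T2RecChargeStepFourFace` ∕ `PairFormPeriodTowerBase` currency VERBATIM):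
* §1 **`faceRead_conj_add`** (additivity of `FF_M` over a sum of two `LocStencil₂` tables, conjunctive-mask form); **`faceRead_lin4_coDress_bondSym`** — the transport row with the
  slot-transposed read rewritten as the bond-swapped read: `FF_P(lin4 c G̃_j Lc X)(μ,ν) = (c·K_j⁴∕2)·FFsym_{Lc·P}(X)(μ,ν)` (every jointly covariant `LocStencil₂` `X`).
* §2 **`faceRead_member_succ`** — `FF_P(T̃_{j+1})(μ,ν;α,β) = FF_P(b̃_j)(μ,ν;α,β) + (c·K_j⁴∕2)·FFsym_{Lc·P}(T̃_j)(μ,ν;α,β)`; **`faceReadSym_member_succ`** — the bond-symmetrised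
  form `FFsym_P(T̃_{j+1}) = FFsym_P(b̃_j) + c·K_j⁴·FFsym_{Lc·P}(T̃_j)`.
* (PART 2 `CombChargeTowerStepDeepRows`) §3 **`legBondSym_faceRead_member_succ`** — the `LS` row: `LS(FFsym_P(T̃_{j+1})) = LS(FFsym_P(b̃_j)) + c·K_j⁴·LS(FFsym_{Lc·P}(T̃_j))`; **`towerStepDeep_of_forcingPairForm`** —
  `hstep (m ≥ 1, j)` of `PairFormPeriodTower.pairFormLS_tower₂` in its `∃ T antisym²` shape VERBATIM, with `Z m i := FFsym_{P_m}(T̃_i)`, `P_{m+1} = Lc·P_m`, `c m j = c·K_j⁴`,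
  ⟸ «`LS(FFsym_{P_m}(b̃_j))` is a pair form» (same witness); **`forcingFacePairForm_of_rows`** — conversely.
* (PART 3 `CombChargeTowerStepDeepPin`) §4 AT THE PINS (`d = 3`, `cE₂ = Lc⁸`; `cE cVH cΛ cB Tc` and the border letters free): **`transportCoeff_eq_one_of_pin`** (`c·K_j⁴ = Lc¹⁶·(Lc^{5j}∕(Lc^{5j}·Lc⁴))⁴ = 1`),
  **`faceReadSym_member_succ_pin`**, **`towerStepDeep_pin_of_forcingPairForm`** (`c m j = 1`).
Asserts NO value and NO shape of Bałaban's tables; discharges NOTHING of (C)_{≥1} ∕ `hstep` ∕ `hSrc` ∕ `hSrcX` ∕ (G14) (the forcing's face pair forms are HYPOTHESES — the suppliers':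
leaf-06's K6c `fourFace_dressedSource_inl_inl` opens `FF(b̃_j)` into leaf-04's three words with legs one class deeper), nor (Q-L); NEVER «G-an2-4 closed» as (CONV-C); NOT D1, NOT
`BetaPertH`, NOT continuum, NOT Clay.  2026-08-24; no existing file touched.
-/

noncomputable section

open Finset
open scoped BigOperators
open Literature.MathematicalPhysics.QuantumFieldTheory
open Literature.MathematicalPhysics.QuantumFieldTheory.Balaban1983to89
open Literature.MathematicalPhysics.QuantumFieldTheory.Balaban1983to89.Beta
open B12Sec2to5 (l1)
open ExpKernelCalculus (Site MKer Decays shiftK)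
open OneStepResolventKernel (Fib)
open OneStepKernelFamily (KInvStep)
open BalabanCompositeJets (LocStencil₂)
open SecondOrderResponse (W2SymOfK)
open BalabanStepJetsSucc (mmRead)
open BalabanStepW2 (K3OfK M2Of)
open AffineAveraging (box toSite)
open AveragingMixedJetTables (mixFFAt)
open Summit.QuantumFields.BalabanUV.Beta.AxialDressingRooted (coDressKBmAt decays_coDressKBmAt_KInvStep)
open Summit.QuantumFields.BalabanUV.Beta.BorderedHessian (stepScale)
open Summit.QuantumFields.BalabanUV.Beta.HessKerDressedUnits (unitK unitS decays_unitK)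
open Summit.QuantumFields.BalabanUV.Beta.SecondOrderUnits (unitM unitS₂ unitM₂)
open Summit.QuantumFields.BalabanUV.Beta.SpineRooted (T2RecAt SpureRecAt M1At)
open Summit.QuantumFields.BalabanUV.Beta.GAN24.CombesThomas (sfStep smStep)
open Summit.QuantumFields.BalabanUV.Beta.GAN24.BiStencilZeroMode (Tab)
open Summit.QuantumFields.BalabanUV.Beta.GAN24.T2RecursionAffine (lin4)
open Summit.QuantumFields.BalabanUV.Beta.GAN24.Lin4ZeroMode (locStencil₂_lin4)
open Summit.QuantumFields.BalabanUV.Beta.GAN24.LinT2CoDressedStep (lin4_comb_coDressKBmAt)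
open Summit.QuantumFields.BalabanUV.Beta.GAN24.T2RecChargeStep (shape_member member_translate succ_eq_lin4_dress_add)
open Summit.QuantumFields.BalabanUV.Beta.GAN24.T2RecChargeStepMap (shape_source)
open Summit.QuantumFields.BalabanUV.Beta.GAN24.TableDressingZeroMode (ite_tsum)
open Summit.QuantumFields.BalabanUV.Beta.GAN24.FaceReadTranspose (faceRead_transpose_of_cov)
open Summit.QuantumFields.BalabanUV.Beta.GAN24.FaceReadTransportCharges (locStencil₂_third ite_and₄_eq_nested nestedFace_add)
open Summit.QuantumFields.BalabanUV.Beta.GAN24.FaceReadTransportStep (faceRead_lin4_coDress)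

namespace Summit.QuantumFields.BalabanUV.Beta.GAN24.CombChargeTowerStepDeep

variable {d : ℕ} {Lc : ℕ} [NeZero Lc] {r : Fin (d + 1) → ℕ}

/-! ## §1 Additivity of the conjunctive-mask face read; the transport row in bond-symmetrised form -/

omit [NeZero Lc] in
/-- [folklore] The conjunctive-mask triple series as three nested masks (push the outer conditions through the series). -/
theorem tsum3_conj_eq_nested (M : ℤ) (A : Prop) [Decidable A] (ν α β : Fin (d + 1)) (v : Site (d + 1) → Site (d + 1) → Site (d + 1) → ℝ) :
    (∑' u' : Site (d + 1), ∑' x : Site (d + 1), ∑' z : Site (d + 1),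
        (if A ∧ u' ν % M = M - 1 ∧ x α % M = M - 1 ∧ z β % M = M - 1 then v u' x z else 0))
      = (if A then (∑' u' : Site (d + 1), (if u' ν % M = M - 1 then
          ∑' x : Site (d + 1), ∑' z : Site (d + 1), (if x α % M = M - 1 ∧ z β % M = M - 1 then v u' x z else 0) else 0)) else 0) := by
  rw [ite_tsum]
  refine tsum_congr fun u' => ?_
  rw [ite_tsum, ite_tsum]
  refine tsum_congr fun x => ?_
  rw [ite_tsum, ite_tsum]
  refine tsum_congr fun z => ?_
  rw [ite_and₄_eq_nested]

omit [NeZero Lc] in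
/-- NOT IN PRINT; OUR BOOKKEEPING.  **THE CONJUNCTIVE-MASK FACE READ IS ADDITIVE OVER A SUM OF TWO `LocStencil₂` TABLES** (any modulus `M`, any cell `s`; summability of every
section from `LocStencil₂` — `FaceReadTransportCharges.nestedFace_add`). -/
theorem faceRead_conj_add (M : ℤ) (s : Finset (Fin (d + 1) → ℕ)) {Y Y' : Tab d} {C C' δ δ' : ℝ}
    (hY : LocStencil₂ Y C δ) (hδ : 0 < δ) (hY' : LocStencil₂ Y' C' δ') (hδ' : 0 < δ') (μ ν α β : Fin (d + 1)) :
    ∑ b ∈ s, ∑' u' : Site (d + 1), ∑' x : Site (d + 1), ∑' z : Site (d + 1),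
        (if toSite b μ % M = M - 1 ∧ u' ν % M = M - 1 ∧ x α % M = M - 1 ∧ z β % M = M - 1 then
          (Y + Y') μ (toSite b) ν u' x z (Sum.inl α) (Sum.inl β) else 0)
      = (∑ b ∈ s, ∑' u' : Site (d + 1), ∑' x : Site (d + 1), ∑' z : Site (d + 1),
          (if toSite b μ % M = M - 1 ∧ u' ν % M = M - 1 ∧ x α % M = M - 1 ∧ z β % M = M - 1 then
            Y μ (toSite b) ν u' x z (Sum.inl α) (Sum.inl β) else 0))
        + (∑ b ∈ s, ∑' u' : Site (d + 1), ∑' x : Site (d + 1), ∑' z : Site (d + 1),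
          (if toSite b μ % M = M - 1 ∧ u' ν % M = M - 1 ∧ x α % M = M - 1 ∧ z β % M = M - 1 then
            Y' μ (toSite b) ν u' x z (Sum.inl α) (Sum.inl β) else 0)) := by
  classical
  rw [← Finset.sum_add_distrib]
  refine Finset.sum_congr rfl fun b _ => ?_
  simp only [Pi.add_apply]
  rw [tsum3_conj_eq_nested M _ ν α β (fun u' x z => Y μ (toSite b) ν u' x z (Sum.inl α) (Sum.inl β) + Y' μ (toSite b) ν u' x z (Sum.inl α) (Sum.inl β)),
    tsum3_conj_eq_nested M _ ν α β (fun u' x z => Y μ (toSite b) ν u' x z (Sum.inl α) (Sum.inl β)),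
    tsum3_conj_eq_nested M _ ν α β (fun u' x z => Y' μ (toSite b) ν u' x z (Sum.inl α) (Sum.inl β))]
  by_cases hb : toSite b μ % M = M - 1
  · simp only [if_pos hb]
    exact nestedFace_add (M := M) hY hδ hY' hδ' μ (toSite b) ν α β
  · simp only [if_neg hb, add_zero]

/-- NOT IN PRINT; OUR BOOKKEEPING.  **THE TRANSPORT ROW, BOND-SYMMETRISED LOWER READ**: `FaceReadTransportStep.faceRead_lin4_coDress` with the read of the slot transpose
`Xᵀ` rewritten as the bond-swapped read of `X` (the OWNER's `FaceReadTranspose.faceRead_transpose_of_cov` at period `Lc·P`; joint covariance at period `Lc·P` from period `Lc`):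
`FF_P(lin4 c G̃_j Lc X)(μ,ν;α,β) = (c·K_j⁴∕2)·(FF_{Lc·P}(X)(μ,ν;α,β) + FF_{Lc·P}(X)(ν,μ;α,β))`. -/
theorem faceRead_lin4_coDress_bondSym (hLc : 1 ≤ Lc) (hr : r ∈ box (d + 1) Lc) (sf sm c : ℝ) (j : ℕ) {P : ℕ} [NeZero (Lc * P)] (hP : 1 ≤ P)
    {X : Tab d} {C δ : ℝ} (hX : LocStencil₂ X C δ) (hδ : 0 < δ)
    (hXcov : ∀ κ u κ' u' t, X κ (u + (Lc : ℤ) • t) κ' (u' + (Lc : ℤ) • t) = shiftK (-((Lc : ℤ) • t)) (X κ u κ' u'))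
    (μ ν α β : Fin (d + 1)) :
    (∑ b ∈ box (d + 1) P, ∑' u' : Site (d + 1), ∑' x : Site (d + 1), ∑' z : Site (d + 1),
          (if toSite b μ % (P : ℤ) = (P : ℤ) - 1 ∧ u' ν % (P : ℤ) = (P : ℤ) - 1 ∧ x α % (P : ℤ) = (P : ℤ) - 1 ∧ z β % (P : ℤ) = (P : ℤ) - 1 then
            lin4 c (unitK sf sm (coDressKBmAt (toSite r) Lc (KInvStep (d := d) Lc j))) Lc X μ (toSite b) ν u' x z (Sum.inl α) (Sum.inl β) else 0))
      = (c * (sf * sm * (stepScale d Lc j * (Lc : ℝ) ^ (d + 1))⁻¹) ^ 4 / 2) *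
        ( (∑ b ∈ box (d + 1) (Lc * P), ∑' u' : Site (d + 1), ∑' x : Site (d + 1), ∑' z : Site (d + 1),
          (if toSite b μ % ((Lc * P : ℕ) : ℤ) = ((Lc * P : ℕ) : ℤ) - 1 ∧ u' ν % ((Lc * P : ℕ) : ℤ) = ((Lc * P : ℕ) : ℤ) - 1 ∧ x α % ((Lc * P : ℕ) : ℤ) = ((Lc * P : ℕ) : ℤ) - 1 ∧ z β % ((Lc * P : ℕ) : ℤ) = ((Lc * P : ℕ) : ℤ) - 1 then
            X μ (toSite b) ν u' x z (Sum.inl α) (Sum.inl β) else 0))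
        + (∑ b ∈ box (d + 1) (Lc * P), ∑' u' : Site (d + 1), ∑' x : Site (d + 1), ∑' z : Site (d + 1),
          (if toSite b ν % ((Lc * P : ℕ) : ℤ) = ((Lc * P : ℕ) : ℤ) - 1 ∧ u' μ % ((Lc * P : ℕ) : ℤ) = ((Lc * P : ℕ) : ℤ) - 1 ∧ x α % ((Lc * P : ℕ) : ℤ) = ((Lc * P : ℕ) : ℤ) - 1 ∧ z β % ((Lc * P : ℕ) : ℤ) = ((Lc * P : ℕ) : ℤ) - 1 then
            X ν (toSite b) μ u' x z (Sum.inl α) (Sum.inl β) else 0)) ) := by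
  have hcovM : ∀ κ u κ' u' t, X κ (u + ((Lc * P : ℕ) : ℤ) • t) κ' (u' + ((Lc * P : ℕ) : ℤ) • t)
      = shiftK (-(((Lc * P : ℕ) : ℤ) • t)) (X κ u κ' u') := by
    intro κ u κ' u' t
    have e : ((Lc * P : ℕ) : ℤ) • t = (Lc : ℤ) • ((P : ℤ) • t) := by
      funext i; simp only [Pi.smul_apply, smul_eq_mul, Nat.cast_mul]; ring
    rw [e]; exact hXcov κ u κ' u' ((P : ℤ) • t)
  rw [faceRead_lin4_coDress hLc hr sf sm c j hP hX hδ hXcov μ ν α β, faceRead_transpose_of_cov (N := Lc * P) hX hδ hcovM μ ν α β]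

/-! ## §2 The member: the face read of the E-frame step -/

/-- NOT IN PRINT; OUR BOOKKEEPING.  **THE PERIOD-`P` FACE READ OF THE NEXT MEMBER** (generic constants, every `j`, every `P ≥ 1`):
`FF_P(T̃_{j+1})(μ,ν;α,β) = FF_P(b̃_j)(μ,ν;α,β) + (c·K_j⁴∕2)·(FF_{Lc·P}(T̃_j)(μ,ν;α,β) + FF_{Lc·P}(T̃_j)(ν,μ;α,β))` — the E-frame split `T̃_{j+1} = lin4 c G̃_j Lc T̃_j + b̃_j`
(`succ_eq_lin4_dress_add` ⨾ `lin4_comb_coDressKBmAt`), additivity of the face read (§1; `shape_member`, `shape_source`, `locStencil₂_lin4`), the transport row (§1). -/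
theorem faceRead_member_succ (hLc : 1 ≤ Lc) (hr : r ∈ box (d + 1) Lc) (cE cVH cΛ cE₂ cB : ℝ) (Tc : Fin 4 → Fin 4 → Fin 4 → Fin 4 → ℝ)
    {vh₂S : Tab d} (hBff : ∀ κ u κ' u' x z (α β : Fin (d + 1)), vh₂S κ u κ' u' x z (Sum.inl α) (Sum.inl β) = 0)
    (hBmm : ∀ κ u κ' u' x z (μ ν : Fin (d + 1)), vh₂S κ u κ' u' x z (Sum.inr μ) (Sum.inr ν) = 0)
    (hB : ∃ C δ : ℝ, 0 < δ ∧ LocStencil₂ vh₂S C δ)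
    (hBt : ∀ (κ : Fin (d + 1)) (u : Fin (d + 1) → ℤ) (κ' : Fin (d + 1)) (u' t : Fin (d + 1) → ℤ),
      vh₂S κ (u + (Lc : ℤ) • t) κ' (u' + (Lc : ℤ) • t) = shiftK (-((Lc : ℤ) • t)) (vh₂S κ u κ' u'))
    {P : ℕ} [NeZero (Lc * P)] (hP : 1 ≤ P) (j : ℕ) (μ ν α β : Fin (d + 1)) :
    (∑ b ∈ box (d + 1) P, ∑' u' : Site (d + 1), ∑' x : Site (d + 1), ∑' z : Site (d + 1),
          (if toSite b μ % (P : ℤ) = (P : ℤ) - 1 ∧ u' ν % (P : ℤ) = (P : ℤ) - 1 ∧ x α % (P : ℤ) = (P : ℤ) - 1 ∧ z β % (P : ℤ) = (P : ℤ) - 1 then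
            unitS₂ (sfStep Lc (j + 1)) (smStep d Lc (j + 1)) (T2RecAt d Lc (toSite r) cE cVH cΛ cE₂ cB Tc vh₂S (mixFFAt (toSite r) Lc) (j + 1)) μ (toSite b) ν u' x z (Sum.inl α) (Sum.inl β) else 0))
      = (∑ b ∈ box (d + 1) P, ∑' u' : Site (d + 1), ∑' x : Site (d + 1), ∑' z : Site (d + 1),
          (if toSite b μ % (P : ℤ) = (P : ℤ) - 1 ∧ u' ν % (P : ℤ) = (P : ℤ) - 1 ∧ x α % (P : ℤ) = (P : ℤ) - 1 ∧ z β % (P : ℤ) = (P : ℤ) - 1 then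
            (fun κ u κ' u' => (cE₂ * (Lc : ℝ) ^ (2 * (d + 1))) • mmRead Lc (K3OfK (unitK (sfStep Lc j) (smStep d Lc j) (coDressKBmAt (toSite r) Lc (KInvStep (d := d) Lc j))) Lc (unitS (sfStep Lc j) (smStep d Lc j) (SpureRecAt d Lc (toSite r) cE cVH cΛ j)) (unitM (sfStep Lc j) (smStep d Lc j) (M1At d Lc (toSite r) cΛ j)) (W2SymOfK (unitK (sfStep Lc j) (smStep d Lc j) (coDressKBmAt (toSite r) Lc (KInvStep (d := d) Lc j))) Lc (unitS (sfStep Lc j) (smStep d Lc j) (SpureRecAt d Lc (toSite r) cE cVH cΛ j)) (unitM (sfStep Lc j) (smStep d Lc j) (M1At d Lc (toSite r) cΛ j)) 0 (unitM₂ (sfStep Lc j) (smStep d Lc j) (M2Of d Lc (mixFFAt (toSite r) Lc) j))) κ u κ' u') + cB • vh₂S κ u κ' u') μ (toSite b) ν u' x z (Sum.inl α) (Sum.inl β) else 0))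
        + ((cE₂ * (Lc : ℝ) ^ (2 * (d + 1))) * (sfStep Lc j * smStep d Lc j * (stepScale d Lc j * (Lc : ℝ) ^ (d + 1))⁻¹) ^ 4 / 2) *
          ( (∑ b ∈ box (d + 1) (Lc * P), ∑' u' : Site (d + 1), ∑' x : Site (d + 1), ∑' z : Site (d + 1),
          (if toSite b μ % ((Lc * P : ℕ) : ℤ) = ((Lc * P : ℕ) : ℤ) - 1 ∧ u' ν % ((Lc * P : ℕ) : ℤ) = ((Lc * P : ℕ) : ℤ) - 1 ∧ x α % ((Lc * P : ℕ) : ℤ) = ((Lc * P : ℕ) : ℤ) - 1 ∧ z β % ((Lc * P : ℕ) : ℤ) = ((Lc * P : ℕ) : ℤ) - 1 then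
            unitS₂ (sfStep Lc j) (smStep d Lc j) (T2RecAt d Lc (toSite r) cE cVH cΛ cE₂ cB Tc vh₂S (mixFFAt (toSite r) Lc) j) μ (toSite b) ν u' x z (Sum.inl α) (Sum.inl β) else 0))
          + (∑ b ∈ box (d + 1) (Lc * P), ∑' u' : Site (d + 1), ∑' x : Site (d + 1), ∑' z : Site (d + 1),
          (if toSite b ν % ((Lc * P : ℕ) : ℤ) = ((Lc * P : ℕ) : ℤ) - 1 ∧ u' μ % ((Lc * P : ℕ) : ℤ) = ((Lc * P : ℕ) : ℤ) - 1 ∧ x α % ((Lc * P : ℕ) : ℤ) = ((Lc * P : ℕ) : ℤ) - 1 ∧ z β % ((Lc * P : ℕ) : ℤ) = ((Lc * P : ℕ) : ℤ) - 1 then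
            unitS₂ (sfStep Lc j) (smStep d Lc j) (T2RecAt d Lc (toSite r) cE cVH cΛ cE₂ cB Tc vh₂S (mixFFAt (toSite r) Lc) j) ν (toSite b) μ u' x z (Sum.inl α) (Sum.inl β) else 0)) ) := by
  obtain ⟨CT, δT, hδT, hT⟩ := shape_member hLc hr cE cVH cΛ cE₂ cB Tc hB j
  obtain ⟨Cb, δb, hδb, hb⟩ := shape_source hLc hr cE cVH cΛ cE₂ cB Tc hBff hBmm hB j
  obtain ⟨m, CK, hm, hCK, hG⟩ := decays_coDressKBmAt_KInvStep (d := d) hr j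
  have hGu : Decays (unitK (sfStep Lc j) (smStep d Lc j) (coDressKBmAt (toSite r) Lc (KInvStep (d := d) Lc j))) (max |sfStep Lc j| |smStep d Lc j| * CK * max |sfStep Lc j| |smStep d Lc j|) m := decays_unitK hG
  have hA := locStencil₂_lin4 hGu (by positivity) hm hLc (cE₂ * (Lc : ℝ) ^ (2 * (d + 1))) hT hδT
  have hTcov := member_translate (r := r) hLc cE cVH cΛ cE₂ cB Tc hBt j
  have hsplit : unitS₂ (sfStep Lc (j + 1)) (smStep d Lc (j + 1)) (T2RecAt d Lc (toSite r) cE cVH cΛ cE₂ cB Tc vh₂S (mixFFAt (toSite r) Lc) (j + 1))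
      = lin4 (cE₂ * (Lc : ℝ) ^ (2 * (d + 1))) (unitK (sfStep Lc j) (smStep d Lc j) (coDressKBmAt (toSite r) Lc (KInvStep (d := d) Lc j))) Lc (unitS₂ (sfStep Lc j) (smStep d Lc j) (T2RecAt d Lc (toSite r) cE cVH cΛ cE₂ cB Tc vh₂S (mixFFAt (toSite r) Lc) j)) + (fun κ u κ' u' => (cE₂ * (Lc : ℝ) ^ (2 * (d + 1))) • mmRead Lc (K3OfK (unitK (sfStep Lc j) (smStep d Lc j) (coDressKBmAt (toSite r) Lc (KInvStep (d := d) Lc j))) Lc (unitS (sfStep Lc j) (smStep d Lc j) (SpureRecAt d Lc (toSite r) cE cVH cΛ j)) (unitM (sfStep Lc j) (smStep d Lc j) (M1At d Lc (toSite r) cΛ j)) (W2SymOfK (unitK (sfStep Lc j) (smStep d Lc j) (coDressKBmAt (toSite r) Lc (KInvStep (d := d) Lc j))) Lc (unitS (sfStep Lc j) (smStep d Lc j) (SpureRecAt d Lc (toSite r) cE cVH cΛ j)) (unitM (sfStep Lc j) (smStep d Lc j) (M1At d Lc (toSite r) cΛ j)) 0 (unitM₂ (sfStep Lc j) (smStep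 d Lc j) (M2Of d Lc (mixFFAt (toSite r) Lc) j))) κ u κ' u') + cB • vh₂S κ u κ' u') := by
    rw [succ_eq_lin4_dress_add hLc hr cE cVH cΛ cE₂ cB Tc hBff hBmm hB j, ← lin4_comb_coDressKBmAt hr j hT hδT]
  rw [hsplit, faceRead_conj_add (P : ℤ) (box (d + 1) P) hA (by positivity) hb hδb μ ν α β,
    faceRead_lin4_coDress_bondSym hLc hr (sfStep Lc j) (smStep d Lc j) (cE₂ * (Lc : ℝ) ^ (2 * (d + 1))) j hP hT hδT hTcov μ ν α β]
  ring

/-- NOT IN PRINT; OUR BOOKKEEPING.  **BOND-SYMMETRISED FORM**: `FFsym_P(T̃_{j+1})(μ,ν;α,β) = FFsym_P(b̃_j)(μ,ν;α,β) + c·K_j⁴·FFsym_{Lc·P}(T̃_j)(μ,ν;α,β)` (two instances of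
`faceRead_member_succ`; the transported term is already bond-symmetric). -/
theorem faceReadSym_member_succ (hLc : 1 ≤ Lc) (hr : r ∈ box (d + 1) Lc) (cE cVH cΛ cE₂ cB : ℝ) (Tc : Fin 4 → Fin 4 → Fin 4 → Fin 4 → ℝ)
    {vh₂S : Tab d} (hBff : ∀ κ u κ' u' x z (α β : Fin (d + 1)), vh₂S κ u κ' u' x z (Sum.inl α) (Sum.inl β) = 0)
    (hBmm : ∀ κ u κ' u' x z (μ ν : Fin (d + 1)), vh₂S κ u κ' u' x z (Sum.inr μ) (Sum.inr ν) = 0)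
    (hB : ∃ C δ : ℝ, 0 < δ ∧ LocStencil₂ vh₂S C δ)
    (hBt : ∀ (κ : Fin (d + 1)) (u : Fin (d + 1) → ℤ) (κ' : Fin (d + 1)) (u' t : Fin (d + 1) → ℤ),
      vh₂S κ (u + (Lc : ℤ) • t) κ' (u' + (Lc : ℤ) • t) = shiftK (-((Lc : ℤ) • t)) (vh₂S κ u κ' u'))
    {P : ℕ} [NeZero (Lc * P)] (hP : 1 ≤ P) (j : ℕ) (μ ν α β : Fin (d + 1)) :
    ((∑ b ∈ box (d + 1) P, ∑' u' : Site (d + 1), ∑' x : Site (d + 1), ∑' z : Site (d + 1),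
          (if toSite b μ % (P : ℤ) = (P : ℤ) - 1 ∧ u' ν % (P : ℤ) = (P : ℤ) - 1 ∧ x α % (P : ℤ) = (P : ℤ) - 1 ∧ z β % (P : ℤ) = (P : ℤ) - 1 then
            unitS₂ (sfStep Lc (j + 1)) (smStep d Lc (j + 1)) (T2RecAt d Lc (toSite r) cE cVH cΛ cE₂ cB Tc vh₂S (mixFFAt (toSite r) Lc) (j + 1)) μ (toSite b) ν u' x z (Sum.inl α) (Sum.inl β) else 0))
        + (∑ b ∈ box (d + 1) P, ∑' u' : Site (d + 1), ∑' x : Site (d + 1), ∑' z : Site (d + 1),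
          (if toSite b ν % (P : ℤ) = (P : ℤ) - 1 ∧ u' μ % (P : ℤ) = (P : ℤ) - 1 ∧ x α % (P : ℤ) = (P : ℤ) - 1 ∧ z β % (P : ℤ) = (P : ℤ) - 1 then
            unitS₂ (sfStep Lc (j + 1)) (smStep d Lc (j + 1)) (T2RecAt d Lc (toSite r) cE cVH cΛ cE₂ cB Tc vh₂S (mixFFAt (toSite r) Lc) (j + 1)) ν (toSite b) μ u' x z (Sum.inl α) (Sum.inl β) else 0)))
      = ((∑ b ∈ box (d + 1) P, ∑' u' : Site (d + 1), ∑' x : Site (d + 1), ∑' z : Site (d + 1),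
          (if toSite b μ % (P : ℤ) = (P : ℤ) - 1 ∧ u' ν % (P : ℤ) = (P : ℤ) - 1 ∧ x α % (P : ℤ) = (P : ℤ) - 1 ∧ z β % (P : ℤ) = (P : ℤ) - 1 then
            (fun κ u κ' u' => (cE₂ * (Lc : ℝ) ^ (2 * (d + 1))) • mmRead Lc (K3OfK (unitK (sfStep Lc j) (smStep d Lc j) (coDressKBmAt (toSite r) Lc (KInvStep (d := d) Lc j))) Lc (unitS (sfStep Lc j) (smStep d Lc j) (SpureRecAt d Lc (toSite r) cE cVH cΛ j)) (unitM (sfStep Lc j) (smStep d Lc j) (M1At d Lc (toSite r) cΛ j)) (W2SymOfK (unitK (sfStep Lc j) (smStep d Lc j) (coDressKBmAt (toSite r) Lc (KInvStep (d := d) Lc j))) Lc (unitS (sfStep Lc j) (smStep d Lc j) (SpureRecAt d Lc (toSite r) cE cVH cΛ j)) (unitM (sfStep Lc j) (smStep d Lc j) (M1At d Lc (toSite r) cΛ j)) 0 (unitM₂ (sfStep Lc j) (smStep d Lc j) (M2Of d Lc (mixFFAt (toSite r) Lc) j))) κ u κ' u') + cB • vh₂S κ u κ' u') μ (toSite b)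 ν u' x z (Sum.inl α) (Sum.inl β) else 0))
        + (∑ b ∈ box (d + 1) P, ∑' u' : Site (d + 1), ∑' x : Site (d + 1), ∑' z : Site (d + 1),
          (if toSite b ν % (P : ℤ) = (P : ℤ) - 1 ∧ u' μ % (P : ℤ) = (P : ℤ) - 1 ∧ x α % (P : ℤ) = (P : ℤ) - 1 ∧ z β % (P : ℤ) = (P : ℤ) - 1 then
            (fun κ u κ' u' => (cE₂ * (Lc : ℝ) ^ (2 * (d + 1))) • mmRead Lc (K3OfK (unitK (sfStep Lc j) (smStep d Lc j) (coDressKBmAt (toSite r) Lc (KInvStep (d := d) Lc j))) Lc (unitS (sfStep Lc j) (smStep d Lc j) (SpureRecAt d Lc (toSite r) cE cVH cΛ j)) (unitM (sfStep Lc j) (smStep d Lc j) (M1At d Lc (toSite r) cΛ j)) (W2SymOfK (unitK (sfStep Lc j) (smStep d Lc j) (coDressKBmAt (toSite r) Lc (KInvStep (d := d) Lc j))) Lc (unitS (sfStep Lc j) (smStep d Lc j) (SpureRecAt d Lc (toSite r) cE cVH cΛ j)) (unitM (sfStep Lc j) (smStep d Lc j) (M1At d Lc (toSite r) cΛ j))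 0 (unitM₂ (sfStep Lc j) (smStep d Lc j) (M2Of d Lc (mixFFAt (toSite r) Lc) j))) κ u κ' u') + cB • vh₂S κ u κ' u') ν (toSite b) μ u' x z (Sum.inl α) (Sum.inl β) else 0)))
        + ((cE₂ * (Lc : ℝ) ^ (2 * (d + 1))) * (sfStep Lc j * smStep d Lc j * (stepScale d Lc j * (Lc : ℝ) ^ (d + 1))⁻¹) ^ 4) *
          ((∑ b ∈ box (d + 1) (Lc * P), ∑' u' : Site (d + 1), ∑' x : Site (d + 1), ∑' z : Site (d + 1),
          (if toSite b μ % ((Lc * P : ℕ) : ℤ) = ((Lc * P : ℕ) : ℤ) - 1 ∧ u' ν % ((Lc * P : ℕ) : ℤ) = ((Lc * P : ℕ) : ℤ) - 1 ∧ x α % ((Lc * P : ℕ) : ℤ) = ((Lc * P : ℕ) : ℤ) - 1 ∧ z β % ((Lc * P : ℕ) : ℤ) = ((Lc * P : ℕ) : ℤ) - 1 then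
            unitS₂ (sfStep Lc j) (smStep d Lc j) (T2RecAt d Lc (toSite r) cE cVH cΛ cE₂ cB Tc vh₂S (mixFFAt (toSite r) Lc) j) μ (toSite b) ν u' x z (Sum.inl α) (Sum.inl β) else 0))
        + (∑ b ∈ box (d + 1) (Lc * P), ∑' u' : Site (d + 1), ∑' x : Site (d + 1), ∑' z : Site (d + 1),
          (if toSite b ν % ((Lc * P : ℕ) : ℤ) = ((Lc * P : ℕ) : ℤ) - 1 ∧ u' μ % ((Lc * P : ℕ) : ℤ) = ((Lc * P : ℕ) : ℤ) - 1 ∧ x α % ((Lc * P : ℕ) : ℤ) = ((Lc * P : ℕ) : ℤ) - 1 ∧ z β % ((Lc * P : ℕ) : ℤ) = ((Lc * P : ℕ) : ℤ) - 1 then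
            unitS₂ (sfStep Lc j) (smStep d Lc j) (T2RecAt d Lc (toSite r) cE cVH cΛ cE₂ cB Tc vh₂S (mixFFAt (toSite r) Lc) j) ν (toSite b) μ u' x z (Sum.inl α) (Sum.inl β) else 0))) := by
  rw [faceRead_member_succ hLc hr cE cVH cΛ cE₂ cB Tc hBff hBmm hB hBt hP j μ ν α β, faceRead_member_succ hLc hr cE cVH cΛ cE₂ cB Tc hBff hBmm hB hBt hP j ν μ α β]
  ring

end Summit.QuantumFields.BalabanUV.Beta.GAN24.CombChargeTowerStepDeep

end
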